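import Mathlib
import HarnessLib
import Summits.HubbardSuperconductivity.HubbardSuperconductivity.Theorems.KLProgrammeC4aPPKernelTrueNumeratorD2

/-!
# Route `KLProgramme` — crux C4a, S3 brick (B4) «(B4)-UMK1», «(M1)-TRUE-KERNEL»: the true numerator is `C²` in the partner level —
# continuity of `∂ᵤ²N`, `contDiff_two_ppTrueNumerator_u`, and a `C²`-from-derivatives helper for the split

Cell `gate-hubbard-kl`, seat hubbard-kl-k3c3-p1 (g15; row «δμ-flow with klAngularMean constant piece»).  Input of the (N2)-grade one-call package (memo `M1-TRUE-KERNEL.md` §10):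
k3c3-p3's `…C4aPreCausticLevelLineSplit.abs_intervalIntegral_levelLine_split_le` / `…C4aFoldBoxPreLaw` take `ContDiff ℝ 2 (K e)`.
* `continuous_uvWeightFnD2_level` (`W″(ω,·)` continuous: `χ ∈ C^∞`), `continuous_ppTrueNumeratorDuu_u` (dominated series), **`contDiff_two_ppTrueNumerator_u`**
  (`u ↦ N(e,u)` is `C²`, derivatives `ppTrueNumeratorDu`, `ppTrueNumeratorDuu`), `deriv_ppTrueNumerator_u`, `deriv_ppTrueNumeratorDu_u`;
* `contDiff_two_of_hasDerivAt₂` (`κ, κ′` with `HasDerivAt` everywhere and `κ″` continuous ⟹ `ContDiff ℝ 2 κ`).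
Pure real analysis; nothing asserts (C), K3 or superconductivity.
References: BGM 2006 §2.4 (2.36) [cite: BenfattoGiulianiMastropietro2006]; Salmhofer 1999 §4.2.5 [cite: Salmhofer1999].
-/

noncomputable section

namespace Summit.HubbardSuperconductivity.HubbardSuperconductivity.Theorems.C4a

set_option linter.dupNamespace false -- summit = problem name (single-conjunct summit), D-0017

open Real Filter Set
open scoped Topology
open Literature.MathematicalPhysics.QuantumLattice Literature.Analysis.SpecialFunctions

/-- `W″(ω,·)` is continuous in the level (`χ` is smooth). [cite: Salmhofer1999, §4.2.5 (4.70)] -/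
theorem continuous_uvWeightFnD2_level (Λ ω : ℝ) : Continuous (uvWeightFnD2 Λ ω) := by
  have h2 : Continuous (deriv (deriv salmhoferCutoff)) := by
    have h := (contDiff_salmhoferCutoff (n := ⊤)).iterate_deriv 2
    exact h.continuous
  have h1 : Continuous (deriv salmhoferCutoff) := by
    have h := (contDiff_salmhoferCutoff (n := ⊤)).iterate_deriv 1
    exact h.continuous
  unfold uvWeightFnD2
  fun_prop

/-- **`u ↦ ∂ᵤ²N(e,u)` is continuous** (dominated series). [cite: BenfattoGiulianiMastropietro2006, §2.4 (2.36)] -/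
theorem continuous_ppTrueNumeratorDuu_u {β Λ : ℝ} (hβ : 0 < β) (hΛ : 0 < Λ) {B₁ B₂ : ℝ} (hB₁ : ∀ x, |deriv salmhoferCutoff x| ≤ B₁)
    (hB₂ : ∀ x, |deriv (deriv salmhoferCutoff) x| ≤ B₂) (e : ℝ) : Continuous fun u : ℝ => ppTrueNumeratorDuu β Λ e u := by
  have hB0 := salmhoferB₁_nonneg hB₁
  have hB20 : 0 ≤ B₂ := (abs_nonneg _).trans (hB₂ 0)
  have hω : ∀ n : ℕ, 0 < ppFreq β n := ppFreq_pos hβ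
  have hωπ := inv_ppFreq_le hβ
  unfold ppTrueNumeratorDuu
  refine continuous_const.mul ?_
  -- the same dominator as in `hasDerivAt_ppTrueNumeratorDu_u`
  set a : ℝ := (4 * B₂ + 2 * B₁) / Λ ^ 2 * (|e| * (β / π) ^ 2 + β / π) with ha
  set b : ℝ := 2 * (2 * B₁ / Λ) * (β / π) ^ 2 with hb
  set c : ℝ := 3 * (β / π) with hc
  refine continuous_tsum (fun n => ?_) (summable_ppD2Dominator (Λ := Λ) hβ a b c) fun n v => ?_
  · have hω0 := hω n
    have hW : Continuous fun u : ℝ => uvWeightFn Λ (ppFreq β n) u := continuous_uvWeightFn_level Λ _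
    have hW1 : Continuous fun u : ℝ => uvWeightFnD1 Λ (ppFreq β n) u := continuous_uvWeightFnD1_level Λ _
    have hW2 : Continuous fun u : ℝ => uvWeightFnD2 Λ (ppFreq β n) u := continuous_uvWeightFnD2_level Λ _
    have hne : ∀ u : ℝ, ppFreq β n ^ 2 + u ^ 2 ≠ 0 := fun u => by positivity
    have hL : Continuous fun u : ℝ => u / (ppFreq β n ^ 2 + u ^ 2) := Continuous.div (by fun_prop) (by fun_prop) hne
    have hL1 : Continuous fun u : ℝ => (ppFreq β n ^ 2 - u ^ 2) / (ppFreq β n ^ 2 + u ^ 2) ^ 2 :=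
      Continuous.div (by fun_prop) (by fun_prop) fun u => pow_ne_zero 2 (hne u)
    have hL2 : Continuous fun u : ℝ => 2 * u * (u ^ 2 - 3 * ppFreq β n ^ 2) / (ppFreq β n ^ 2 + u ^ 2) ^ 3 :=
      Continuous.div (by fun_prop) (by fun_prop) fun u => pow_ne_zero 3 (hne u)
    have h : Continuous fun u : ℝ => uvWeightFn Λ (ppFreq β n) e *
        (uvWeightFnD2 Λ (ppFreq β n) u * (e / (ppFreq β n ^ 2 + e ^ 2) + u / (ppFreq β n ^ 2 + u ^ 2)) +
          2 * uvWeightFnD1 Λ (ppFreq β n) u * ((ppFreq β n ^ 2 - u ^ 2) / (ppFreq β n ^ 2 + u ^ 2) ^ 2) +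
          uvWeightFn Λ (ppFreq β n) u * (2 * u * (u ^ 2 - 3 * ppFreq β n ^ 2) / (ppFreq β n ^ 2 + u ^ 2) ^ 3)) :=
      continuous_const.mul (((hW2.mul (continuous_const.add hL)).add ((continuous_const.mul hW1).mul hL1)).add (hW.mul hL2))
    exact h
  · -- dominator (verbatim from `hasDerivAt_ppTrueNumeratorDu_u`)
    have hLe : |e / (ppFreq β n ^ 2 + e ^ 2)| ≤ |e| * (β / π) ^ 2 := by
      refine (abs_lorentzian_le_abs_div_sq (hω n).ne' e).trans ?_
      rw [div_eq_mul_one_div]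
      refine mul_le_mul_of_nonneg_left ?_ (abs_nonneg e)
      calc 1 / ppFreq β n ^ 2 = (1 / ppFreq β n) ^ 2 := by rw [one_div_pow]
        _ ≤ (β / π) ^ 2 := pow_le_pow_left₀ (by have := hω n; positivity) (hωπ n) 2
    have hLv : |v / (ppFreq β n ^ 2 + v ^ 2)| ≤ β / π :=
      (abs_lorentzian_le_half_inv (hω n) v).trans (by
        calc 1 / (2 * ppFreq β n) = (1 / ppFreq β n) / 2 := by field_simp
          _ ≤ (β / π) / 2 := by have := hωπ n; linarith
          _ ≤ β / π := by linarith [show 0 < β / π by positivity])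
    have hL1 : |(ppFreq β n ^ 2 - v ^ 2) / (ppFreq β n ^ 2 + v ^ 2) ^ 2| ≤ (β / π) ^ 2 := by
      refine (abs_lorentzian_deriv_le_inv (by have := hω n; positivity)).trans ?_
      calc 1 / (ppFreq β n ^ 2 + v ^ 2) ≤ 1 / ppFreq β n ^ 2 := one_div_le_one_div_of_le (pow_pos (hω n) 2) (by nlinarith [sq_nonneg v])
        _ = (1 / ppFreq β n) ^ 2 := by rw [one_div_pow]
        _ ≤ (β / π) ^ 2 := pow_le_pow_left₀ (by have := hω n; positivity) (hωπ n) 2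
    have hL2 : |2 * v * (v ^ 2 - 3 * ppFreq β n ^ 2) / (ppFreq β n ^ 2 + v ^ 2) ^ 3| ≤ 3 * (β / π) * (1 / (ppFreq β n ^ 2 + 0 ^ 2)) := by
      refine (abs_lorentzian_deriv2_le_cube (hω n) v).trans ?_
      rw [zero_pow two_ne_zero, add_zero]
      have h0 : 0 ≤ 1 / ppFreq β n ^ 2 := by have := hω n; positivity
      calc 3 / ppFreq β n ^ 3 = 3 * (1 / ppFreq β n) * (1 / ppFreq β n ^ 2) := by field_simp
        _ ≤ 3 * (β / π) * (1 / ppFreq β n ^ 2) := mul_le_mul_of_nonneg_right (mul_le_mul_of_nonneg_left (hωπ n) (by norm_num)) h0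
    have hWe : |uvWeightFn Λ (ppFreq β n) e| ≤ 1 := abs_uvWeightFn_le_one _ _ _
    have hWv : |uvWeightFn Λ (ppFreq β n) v| ≤ 1 := abs_uvWeightFn_le_one _ _ _
    have hD1 := abs_uvWeightFnD1_le_shell hB₁ hΛ (ppFreq β n) v
    have hD2 := abs_uvWeightFnD2_le_shell hB₁ hB₂ hΛ (ppFreq β n) v
    rw [Real.norm_eq_abs, abs_mul]
    have hsum : |e / (ppFreq β n ^ 2 + e ^ 2) + v / (ppFreq β n ^ 2 + v ^ 2)| ≤ |e| * (β / π) ^ 2 + β / π :=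
      (abs_add_le _ _).trans (add_le_add hLe hLv)
    have hp1 : |uvWeightFnD2 Λ (ppFreq β n) v * (e / (ppFreq β n ^ 2 + e ^ 2) + v / (ppFreq β n ^ 2 + v ^ 2))| ≤
        (4 * B₂ + 2 * B₁) / Λ ^ 2 * (2 * Λ ^ 2 / (ppFreq β n ^ 2 + Λ ^ 2)) * (|e| * (β / π) ^ 2 + β / π) := by
      rw [abs_mul]; exact mul_le_mul hD2 hsum (abs_nonneg _) (by positivity)
    have hp2 : |2 * uvWeightFnD1 Λ (ppFreq β n) v * ((ppFreq β n ^ 2 - v ^ 2) / (ppFreq β n ^ 2 + v ^ 2) ^ 2)| ≤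
        2 * (2 * B₁ / Λ * (2 * Λ ^ 2 / (ppFreq β n ^ 2 + Λ ^ 2))) * (β / π) ^ 2 := by
      rw [abs_mul, abs_mul, abs_of_pos (by norm_num : (0 : ℝ) < 2)]
      exact mul_le_mul (mul_le_mul_of_nonneg_left hD1 (by norm_num)) hL1 (abs_nonneg _) (by positivity)
    have hp3 : |uvWeightFn Λ (ppFreq β n) v * (2 * v * (v ^ 2 - 3 * ppFreq β n ^ 2) / (ppFreq β n ^ 2 + v ^ 2) ^ 3)| ≤
        1 * (3 * (β / π) * (1 / (ppFreq β n ^ 2 + 0 ^ 2))) := by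
      rw [abs_mul]; exact mul_le_mul hWv hL2 (abs_nonneg _) zero_le_one
    calc |uvWeightFn Λ (ppFreq β n) e| * |uvWeightFnD2 Λ (ppFreq β n) v * (e / (ppFreq β n ^ 2 + e ^ 2) + v / (ppFreq β n ^ 2 + v ^ 2)) +
          2 * uvWeightFnD1 Λ (ppFreq β n) v * ((ppFreq β n ^ 2 - v ^ 2) / (ppFreq β n ^ 2 + v ^ 2) ^ 2) +
          uvWeightFn Λ (ppFreq β n) v * (2 * v * (v ^ 2 - 3 * ppFreq β n ^ 2) / (ppFreq β n ^ 2 + v ^ 2) ^ 3)|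
        ≤ 1 * ((4 * B₂ + 2 * B₁) / Λ ^ 2 * (2 * Λ ^ 2 / (ppFreq β n ^ 2 + Λ ^ 2)) * (|e| * (β / π) ^ 2 + β / π) +
            2 * (2 * B₁ / Λ * (2 * Λ ^ 2 / (ppFreq β n ^ 2 + Λ ^ 2))) * (β / π) ^ 2 + 1 * (3 * (β / π) * (1 / (ppFreq β n ^ 2 + 0 ^ 2)))) :=
          mul_le_mul hWe ((abs_add_le _ _).trans (add_le_add ((abs_add_le _ _).trans (add_le_add hp1 hp2)) hp3)) (abs_nonneg _) zero_le_one
      _ = a * (2 * Λ ^ 2 / (ppFreq β n ^ 2 + Λ ^ 2)) + b * (2 * Λ ^ 2 / (ppFreq β n ^ 2 + Λ ^ 2)) + c * (1 / (ppFreq β n ^ 2 + 0 ^ 2)) := by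
          rw [ha, hb, hc]; ring

/-- `deriv N(e,·) = ∂ᵤN`. [cite: BenfattoGiulianiMastropietro2006, §2.4 (2.36)] -/
theorem deriv_ppTrueNumerator_u {β Λ : ℝ} (hβ : 0 < β) (hΛ : 0 < Λ) {B₁ : ℝ} (hB₁ : ∀ x, |deriv salmhoferCutoff x| ≤ B₁) (e : ℝ) :
    deriv (fun u => ppTrueNumerator β Λ e u) = fun u => ppTrueNumeratorDu β Λ e u :=
  funext fun u => (hasDerivAt_ppTrueNumerator_u hβ hΛ hB₁ e u).deriv

/-- `deriv ∂ᵤN(e,·) = ∂ᵤ²N`. [cite: BenfattoGiulianiMastropietro2006, §2.4 (2.36)] -/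
theorem deriv_ppTrueNumeratorDu_u {β Λ : ℝ} (hβ : 0 < β) (hΛ : 0 < Λ) {B₁ B₂ : ℝ} (hB₁ : ∀ x, |deriv salmhoferCutoff x| ≤ B₁)
    (hB₂ : ∀ x, |deriv (deriv salmhoferCutoff) x| ≤ B₂) (e : ℝ) :
    deriv (fun u => ppTrueNumeratorDu β Λ e u) = fun u => ppTrueNumeratorDuu β Λ e u :=
  funext fun u => (hasDerivAt_ppTrueNumeratorDu_u hβ hΛ hB₁ hB₂ e u).deriv

/-- **`u ↦ N(e,u)` is `C²`.** [cite: BenfattoGiulianiMastropietro2006, §2.4 (2.36)] -/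
theorem contDiff_two_ppTrueNumerator_u {β Λ : ℝ} (hβ : 0 < β) (hΛ : 0 < Λ) {B₁ B₂ : ℝ} (hB₁ : ∀ x, |deriv salmhoferCutoff x| ≤ B₁)
    (hB₂ : ∀ x, |deriv (deriv salmhoferCutoff) x| ≤ B₂) (e : ℝ) : ContDiff ℝ 2 (fun u => ppTrueNumerator β Λ e u) := by
  rw [show (2 : WithTop ℕ∞) = 1 + 1 from rfl, contDiff_succ_iff_deriv, deriv_ppTrueNumerator_u hβ hΛ hB₁ e]
  refine ⟨fun u => (hasDerivAt_ppTrueNumerator_u hβ hΛ hB₁ e u).differentiableAt, by simp, ?_⟩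
  rw [contDiff_one_iff_deriv, deriv_ppTrueNumeratorDu_u hβ hΛ hB₁ hB₂ e]
  exact ⟨fun u => (hasDerivAt_ppTrueNumeratorDu_u hβ hΛ hB₁ hB₂ e u).differentiableAt, continuous_ppTrueNumeratorDuu_u hβ hΛ hB₁ hB₂ e⟩

/-- **`C²` from two layers of derivatives**: `HasDerivAt κ (κ′ t) t`, `HasDerivAt κ′ (κ″ t) t` everywhere and `κ″` continuous ⟹ `ContDiff ℝ 2 κ`. [folklore] -/
theorem contDiff_two_of_hasDerivAt₂ {κ κ' κ'' : ℝ → ℝ} (hκ : ∀ t, HasDerivAt κ (κ' t) t) (hκ' : ∀ t, HasDerivAt κ' (κ'' t) t) (hκ''c : Continuous κ'') :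
    ContDiff ℝ 2 κ := by
  have hd : deriv κ = κ' := funext fun t => (hκ t).deriv
  have hd' : deriv κ' = κ'' := funext fun t => (hκ' t).deriv
  rw [show (2 : WithTop ℕ∞) = 1 + 1 from rfl, contDiff_succ_iff_deriv, hd]
  refine ⟨fun t => (hκ t).differentiableAt, by simp, ?_⟩
  rw [contDiff_one_iff_deriv, hd']
  exact ⟨fun t => (hκ' t).differentiableAt, hκ''c⟩

end Summit.HubbardSuperconductivity.HubbardSuperconductivity.Theorems.C4a

end
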